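import Literature.NumberTheory.EllipticCurves.PAdicPowerSeriesZeros
import Literature.NumberTheory.EllipticCurves.PAdicPowerSeriesEvaluationProofs
import Mathlib.Analysis.Normed.Group.FunctionSeries
import HarnessLib

/-!
# Evaluating elements of `Λ = ℤ_p⟦T⟧` at the character points `T = ρ(γ) − 1` of `ℂ_p`

Lang, *Cyclotomic Fields I and II*, Ch. 4 §1 (PDF pp. 78–79) and Washington, *Introduction to
Cyclotomic Fields*, §7.2 / §12.2: a power series `f ∈ ℤ_p⟦T⟧` has a value at every point `z` of
the open unit disc of `ℂ_p`, `f ↦ f(z)` is multiplicative, and the binomial power series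
`(1 + T)^e = ∑ₙ (e choose n) Tⁿ` (`e ∈ ℤ_p`; Lang Ch. 4 §1 Example 1) takes at `T = ζ − 1`, `ζ` a
`p`-power root of unity, the value "`ζ^e`" — for `ζ = ρ(γ)` with `ρ` a character of
`Γ = ℤ_pˣ/μ ≅ 1 + p^{e₀}ℤ_p ∋ γ = 1 + p^{e₀}` this is `ρ(γ^e)`, the image under `ρ` of the unit
`γ^e = cycPow p e ∈ 1 + p^{e₀}ℤ_p` (Washington §7.2: the characters of the second kind are the
characters of `⟨γ⟩`; Mazur–Tate–Teitelbaum 1986 §I.13). These are the evaluation rules behind the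
interpolation of Iwasawa functions at the finite-order characters of `Γ` (Lang Ch. 4 §3 Thm. 3.2 in
the variable `T = ζγ^s − 1`; Greenberg–Vatsal 2000 (26)/(27)).

The tree already has the `ℚ_p`-valued calculus at the points `γ^a − 1`
(`PAdicPowerSeriesEvaluationProofs`: `hasSum_intCoeff_*`, `hasSum_intCoeff_binomialSeries_mul_pow`)
and the `ℂ_p`-valued `tsum` product rule (`PAdicPowerSeriesZeros.tsum_map_coeff_mul_mul_pow`).
This file supplies the `ℂ_p`-valued `HasSum` rules for `Λ`, with the coefficient embedding
`ιZ = (algebraMap ℚ_p ℂ_p) ∘ (algebraMap ℤ_p ℚ_p) : ℤ_p → ℂ_p` (written out in full below, as in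
`PAdicPowerSeriesZeros`):

* `hasSum_cpCoeff_mul`, `hasSum_cpCoeff_inv` — products and inverses of units;
* `norm_apply_cyclotomicGenerator_sub_one_lt` — `|ρ(γ) − 1| < 1` for a character `ρ` of `Γ`;
* `continuous_tsum_cpCoeff_binomialSeries` — `e ↦ (1 + T)^e (z)` is continuous on `ℤ_p`;
* `hasSum_cpCoeff_binomialSeries_natCast` — `(1 + T)^s (z) = (1 + z)^s` for `s ∈ ℕ`;
* `hasSum_cpCoeff_binomialSeries_character` — **`(1 + T)^e` at `T = ρ(γ) − 1` is `ρ(γ^e)`**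
  (`ρ (toZModPow n (cycPow p e))`), by density of `ℕ` in `ℤ_p`: both sides are continuous in `e`
  and agree on `ℕ`;
* `hasSum_cpCoeff_one_sub_C_mul_binomialSeries_character` — the regularising unit
  `1 − a(1+T)^e` of the Kubota–Leopoldt construction (Lang Ch. 4 §3) at `ρ(γ) − 1`;
* `one_sub_mul_ne_zero_of_isUnit_of_norm_sub_one_lt` — its value `1 − aζ'` is non-zero when
  `1 − a` is a unit and `|ζ' − 1| < 1` (`ζ'` a `p`-power root of unity,
  `norm_apply_sub_one_lt_of_isUnit`).

Everything is proved; there are no named facts and no new definitions.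

## References

* S. Lang, *Cyclotomic Fields I and II*, GTM 121, Springer 1990, Ch. 4 §1 Thm. 1.2 and Examples
  1–2 (PDF pp. 78–79), §3 (PDF p. 84). [LangCyclotomic1990]
* L. C. Washington, *Introduction to Cyclotomic Fields*, GTM 83, §7.2 (characters of the second
  kind, `ζ_ρ = ρ(γ)`), §12.2.
* B. Mazur, J. Tate, J. Teitelbaum, Invent. Math. 84 (1986), §I.13. [MazurTateTeitelbaum1986]
-/

noncomputable section

open scoped Classical

open Filter Topology PowerSeries

namespace Literature.NumberTheory.EllipticCurves

open CyclotomicZp PadicOneUnits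

variable {p : ℕ} [Fact p.Prime]

/-! ### Products and inverses -/

/-- **Evaluation of `Λ` on the open unit disc of `ℂ_p` is multiplicative** (`HasSum` form of
`tsum_map_coeff_mul_mul_pow`; Lang Ch. 4 §1 Thm. 1.2). [cite: LangCyclotomic1990, Ch. 4 §1, Thm. 1.2 (PDF p. 79)] -/
theorem hasSum_cpCoeff_mul {A B : PowerSeries ℤ_[p]} {z : ℂ_[p]} (hz : ‖z‖ < 1) {a b : ℂ_[p]}
    (ha : HasSum (fun k ↦ ((algebraMap ℚ_[p] ℂ_[p]).comp (algebraMap ℤ_[p] ℚ_[p])) (coeff k A) * z ^ k) a)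
    (hb : HasSum (fun k ↦ ((algebraMap ℚ_[p] ℂ_[p]).comp (algebraMap ℤ_[p] ℚ_[p])) (coeff k B) * z ^ k) b) :
    HasSum (fun k ↦ ((algebraMap ℚ_[p] ℂ_[p]).comp (algebraMap ℤ_[p] ℚ_[p])) (coeff k (A * B)) * z ^ k) (a * b) := by
  have h := tsum_map_coeff_mul_mul_pow ((algebraMap ℚ_[p] ℂ_[p]).comp (algebraMap ℤ_[p] ℚ_[p])) (norm_algebraMap_coeff_le_one A)
    (norm_algebraMap_coeff_le_one B) hz
  rw [ha.tsum_eq, hb.tsum_eq] at h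
  rw [← h]
  exact (summable_map_coeff_mul_pow ((algebraMap ℚ_[p] ℂ_[p]).comp (algebraMap ℤ_[p] ℚ_[p])) (norm_algebraMap_coeff_le_one (A * B)) hz).hasSum

/-- **The value of the inverse of a unit of `Λ`** at a point of the open unit disc of `ℂ_p` is
the inverse value (and is automatically non-zero): multiplicativity applied to `h h⁻¹ = 1`
(Lang Ch. 4 §1). [cite: LangCyclotomic1990, Ch. 4 §1, Thm. 1.2 (PDF p. 79)] -/
theorem hasSum_cpCoeff_inv {h : (PowerSeries ℤ_[p])ˣ} {z : ℂ_[p]} (hz : ‖z‖ < 1) {w : ℂ_[p]}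
    (hh : HasSum (fun k ↦ ((algebraMap ℚ_[p] ℂ_[p]).comp (algebraMap ℤ_[p] ℚ_[p])) (coeff k (h : PowerSeries ℤ_[p])) * z ^ k) w) :
    HasSum (fun k ↦ ((algebraMap ℚ_[p] ℂ_[p]).comp (algebraMap ℤ_[p] ℚ_[p])) (coeff k (↑h⁻¹ : PowerSeries ℤ_[p])) * z ^ k) w⁻¹ := by
  have hv := (summable_map_coeff_mul_pow ((algebraMap ℚ_[p] ℂ_[p]).comp (algebraMap ℤ_[p] ℚ_[p]))
    (norm_algebraMap_coeff_le_one (↑h⁻¹ : PowerSeries ℤ_[p])) hz).hasSum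
  have hprod := hasSum_cpCoeff_mul hz hh hv
  rw [Units.mul_inv] at hprod
  have h1 : w * _ = 1 := hprod.unique (hasSum_map_coeff_one_mul_pow ((algebraMap ℚ_[p] ℂ_[p]).comp (algebraMap ℤ_[p] ℚ_[p])) z)
  rwa [show w⁻¹ = _ from (eq_inv_of_mul_eq_one_right h1).symm]

/-! ### The character points `ρ(γ) − 1` -/

/-- For a character `ρ` of `Γ` (a Dirichlet character modulo `p^n` with values in `ℂ_p` of
`p`-power order), `ρ(γ)` is a `p`-power root of unity, so **`|ρ(γ) − 1| < 1`**: the point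
`T = ρ(γ) − 1` lies in the open unit disc (Washington §7.2; Mazur–Tate–Teitelbaum §I.13).
[cite: MazurTateTeitelbaum1986, §I.13 (the characters of Γ and the points χ(γ) − 1)] -/
theorem norm_apply_cyclotomicGenerator_sub_one_lt {n : ℕ} (ρ : DirichletCharacter ℂ_[p] (p ^ n))
    (hord : ∃ j : ℕ, orderOf ρ = p ^ j) :
    ‖ρ (cyclotomicGenerator p : ZMod (p ^ n)) - 1‖ < 1 := by
  obtain ⟨j, hj⟩ := hord
  obtain ⟨v, hv⟩ := isUnit_cyclotomicGenerator_cast p n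
  refine norm_sub_one_lt_one_of_pow_prime_pow_eq_one (j := j) ?_
  rw [← hv, ← MulChar.pow_apply_coe, ← hj, pow_orderOf_eq_one, MulChar.one_apply_coe]

/-- The value `ρ(u)` of a character of `p`-power order at a unit is a `p`-power root of unity, hence
`|ρ(u) − 1| < 1`. [cite: MazurTateTeitelbaum1986, §I.13] -/
theorem norm_apply_sub_one_lt_of_isUnit {n : ℕ} (ρ : DirichletCharacter ℂ_[p] (p ^ n))
    (hord : ∃ j : ℕ, orderOf ρ = p ^ j) {u : ZMod (p ^ n)} (hu : IsUnit u) :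
    ‖ρ u - 1‖ < 1 := by
  obtain ⟨j, hj⟩ := hord
  obtain ⟨v, rfl⟩ := hu
  refine norm_sub_one_lt_one_of_pow_prime_pow_eq_one (j := j) ?_
  rw [← MulChar.pow_apply_coe, ← hj, pow_orderOf_eq_one, MulChar.one_apply_coe]

/-! ### The binomial series `(1 + T)^e` at points of `ℂ_p` -/

/-- The coefficient embedding `ℤ_p → ℂ_p` is continuous. [folklore] -/
private theorem continuous_iotaZ : Continuous (((algebraMap ℚ_[p] ℂ_[p]).comp (algebraMap ℤ_[p] ℚ_[p])) : ℤ_[p] → ℂ_[p]) := by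
  have h : (((algebraMap ℚ_[p] ℂ_[p]).comp (algebraMap ℤ_[p] ℚ_[p])) : ℤ_[p] → ℂ_[p]) = fun x : ℤ_[p] ↦ algebraMap ℚ_[p] ℂ_[p] ((x : ℤ_[p]) : ℚ_[p]) := by
    funext x
    rw [RingHom.comp_apply, PadicInt.algebraMap_apply]
  rw [h]
  exact (continuous_algebraMap ℚ_[p] ℂ_[p]).comp continuous_subtype_val

/-- `‖((algebraMap ℚ_[p] ℂ_[p]).comp (algebraMap ℤ_[p] ℚ_[p])) x‖ ≤ 1` for `x ∈ ℤ_p`. [folklore] -/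
private theorem norm_iotaZ_le_one (x : ℤ_[p]) : ‖(((algebraMap ℚ_[p] ℂ_[p]).comp (algebraMap ℤ_[p] ℚ_[p])) : ℤ_[p] → ℂ_[p]) x‖ ≤ 1 := by
  rw [RingHom.comp_apply, norm_algebraMap', PadicInt.algebraMap_apply]
  exact PadicInt.norm_le_one x

/-- **`e ↦ (1 + T)^e (z)` is continuous on `ℤ_p`** for `|z| < 1`: the coefficients
`(e choose n)` are continuous (polynomial) functions of `e` bounded by `1`, and the series is
dominated by `∑ |z|ⁿ` (Lang Ch. 4 §1 Example 1 with Thm. 1.2; Mahler). [cite: LangCyclotomic1990, Ch. 4 §1, Example 1 and Thm. 1.2 (PDF pp. 78–79)] -/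
theorem continuous_tsum_cpCoeff_binomialSeries {z : ℂ_[p]} (hz : ‖z‖ < 1) :
    Continuous fun e : ℤ_[p] ↦ ∑' k, ((algebraMap ℚ_[p] ℂ_[p]).comp (algebraMap ℤ_[p] ℚ_[p])) (coeff k (binomialSeries ℤ_[p] e)) * z ^ k := by
  refine continuous_tsum (fun k ↦ ?_) (summable_geometric_of_lt_one (norm_nonneg z) hz)
    (fun k e ↦ ?_)
  · simp only [binomialSeries_coeff, smul_eq_mul, mul_one]
    exact (continuous_iotaZ.comp (PadicInt.continuous_choose k)).mul continuous_const
  · rw [norm_mul, norm_pow]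
    calc _ ≤ 1 * ‖z‖ ^ k := by gcongr; exact norm_iotaZ_le_one _
      _ = _ := one_mul _

/-- **`(1 + T)^s (z) = (1 + z)^s` for a natural number `s`** (the binomial theorem; Lang Ch. 4 §1
Example 1 "`∑ (s choose k) X^k = (1 + X)^s`"). [cite: LangCyclotomic1990, Ch. 4 §1, Example 1 (PDF p. 79)] -/
theorem hasSum_cpCoeff_binomialSeries_natCast (s : ℕ) (z : ℂ_[p]) :
    HasSum (fun k ↦ ((algebraMap ℚ_[p] ℂ_[p]).comp (algebraMap ℤ_[p] ℚ_[p])) (coeff k (binomialSeries ℤ_[p] (s : ℤ_[p]))) * z ^ k) ((1 + z) ^ s) := by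
  have hterm : ∀ k, ((algebraMap ℚ_[p] ℂ_[p]).comp (algebraMap ℤ_[p] ℚ_[p])) (coeff k (binomialSeries ℤ_[p] (s : ℤ_[p]))) * z ^ k =
      ((s.choose k : ℕ) : ℂ_[p]) * z ^ k := fun k ↦ by
    rw [binomialSeries_coeff, smul_eq_mul, mul_one, Ring.choose_natCast, map_natCast]
  simp_rw [hterm]
  have hzero : ∀ k ∉ Finset.range (s + 1), ((s.choose k : ℕ) : ℂ_[p]) * z ^ k = 0 := by
    intro k hk
    rw [Finset.mem_range, not_lt] at hk
    rw [Nat.choose_eq_zero_of_lt (by omega), Nat.cast_zero, zero_mul]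
  have hsum : (1 + z) ^ s = ∑ k ∈ Finset.range (s + 1), ((s.choose k : ℕ) : ℂ_[p]) * z ^ k := by
    rw [add_comm, add_pow]
    exact Finset.sum_congr rfl fun k _ ↦ by rw [one_pow, mul_one, mul_comm]
  rw [hsum]
  exact hasSum_sum_of_ne_finset_zero hzero

/-- `γ^s` (`s ∈ ℕ`) reduces modulo `p^n` to the `s`-th power of the class of `γ` (Lang Ch. 4 §1
Ex. 2: `x ↦ γ^x` extends the integer powers of `γ`). [cite: LangCyclotomic1990, Ch. 4 §1, Example 2 (PDF p. 79)] -/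
theorem toZModPow_cycPow_natCast (n s : ℕ) :
    PadicInt.toZModPow n (cycPow p (s : ℤ_[p])) = (cyclotomicGenerator p : ZMod (p ^ n)) ^ s := by
  rw [show (s : ℤ_[p]) = s • (1 : ℤ_[p]) by simp, AddChar.map_nsmul_eq_pow, cycPow_one, map_pow,
    map_natCast]

/-- `‖γ^x − 1‖ ≤ ‖x‖`: `γ^x ≡ 1 (mod x p^{e₀})` (Serre, *Cours d'arithmétique* II.3.2, Lemma and
Prop. 8: `θ_α : z ↦ α^z` maps `p^nℤ_p` onto `U_{n+e₀}`; the tree's `norm_oneAddPow_sub_one`).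
[cite: Serre1973, Ch. II §3.2 Prop. 8 (and the Lemma before it)] -/
theorem norm_cycPow_sub_one_le (x : ℤ_[p]) : ‖cycPow p x - 1‖ ≤ ‖x‖ := by
  rw [cycPow, norm_oneAddPow_sub_one _ (cyclotomicExponent_cond p) x]
  calc ‖x‖ * ‖(p : ℤ_[p]) ^ (cyclotomicExponent p - 1 + 1)‖ ≤ ‖x‖ * 1 := by
        gcongr; exact PadicInt.norm_le_one _
    _ = ‖x‖ := mul_one _

/-- **`e ↦ ρ(γ^e mod p^n)` is continuous (locally constant) on `ℤ_p`**: if `e' ≡ e (mod p^n)`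
then `γ^{e'} ≡ γ^{e} (mod p^n)`. [cite: MazurTateTeitelbaum1986, §I.13 (Γ ≅ 1 + p^{e₀}ℤ_p = γ^{ℤ_p}, characters of conductor p^n)] -/
theorem continuous_apply_toZModPow_cycPow {n : ℕ} (ρ : DirichletCharacter ℂ_[p] (p ^ n)) :
    Continuous fun e : ℤ_[p] ↦ ρ (PadicInt.toZModPow n (cycPow p e)) := by
  have hp : p.Prime := Fact.out
  rw [Metric.continuous_iff]
  intro e ε hε
  refine ⟨(p : ℝ) ^ (-(n : ℤ)), zpow_pos (by exact_mod_cast hp.pos) _, fun e' he' ↦ ?_⟩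
  -- `e' - e ∈ p^n ℤ_p`... in fact `‖e' - e‖ < p^{-n}` suffices for `γ^{e'-e} ≡ 1 (mod p^n)`
  have hd : ‖cycPow p (e' - e) - 1‖ ≤ (p : ℝ) ^ (-(n : ℤ)) :=
    ((norm_cycPow_sub_one_le (e' - e)).trans (by rw [← dist_eq_norm]; exact he'.le))
  have h1 : PadicInt.toZModPow n (cycPow p (e' - e)) = 1 := by
    rw [PadicInt.norm_le_pow_iff_mem_span_pow, ← PadicInt.ker_toZModPow, RingHom.mem_ker,
      map_sub, map_one, sub_eq_zero] at hd
    exact hd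
  have he'e : cycPow p e' = cycPow p e * cycPow p (e' - e) := by
    rw [← AddChar.map_add_eq_mul, add_sub_cancel]
  rw [he'e, map_mul, h1, mul_one, dist_self]
  exact hε

/-- **`(1 + T)^e` at `T = ρ(γ) − 1` is `ρ(γ^e)`** for every `e ∈ ℤ_p` and every character `ρ` of
`Γ` modulo `p^n` (values in `ℂ_p`, `p`-power order): `∑ₙ (e choose n)(ρ(γ) − 1)ⁿ =
ρ(γ^e mod p^n)` (`γ^e = cycPow p e ∈ 1 + p^{e₀}ℤ_p`). Both sides are continuous functions of `e`
on `ℤ_p` (`continuous_tsum_cpCoeff_binomialSeries`, `continuous_apply_toZModPow_cycPow`) which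
agree on the dense subset `ℕ` by the binomial theorem (`(1 + (ρ(γ) − 1))^s = ρ(γ)^s = ρ(γ^s)`),
hence everywhere (Lang Ch. 4 §1 Examples 1–2: `(1 + X)^s` and `f(γ^s − 1)`; Washington §7.2 /
Thm. 12.2: the values of Iwasawa functions at `ζ_ρ γ^s − 1`). [cite: LangCyclotomic1990, Ch. 4 §1, Examples 1–2 (PDF p. 79)]
[cite: MazurTateTeitelbaum1986, §I.13 (evaluation at χ(γ) − 1)] -/
theorem hasSum_cpCoeff_binomialSeries_character {n : ℕ} (ρ : DirichletCharacter ℂ_[p] (p ^ n))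
    (hord : ∃ j : ℕ, orderOf ρ = p ^ j) (e : ℤ_[p]) :
    HasSum (fun k ↦ ((algebraMap ℚ_[p] ℂ_[p]).comp (algebraMap ℤ_[p] ℚ_[p])) (coeff k (binomialSeries ℤ_[p] e)) *
        (ρ (cyclotomicGenerator p : ZMod (p ^ n)) - 1) ^ k)
      (ρ (PadicInt.toZModPow n (cycPow p e))) := by
  set z : ℂ_[p] := ρ (cyclotomicGenerator p : ZMod (p ^ n)) - 1 with hz_def
  have hz : ‖z‖ < 1 := norm_apply_cyclotomicGenerator_sub_one_lt ρ hord
  set F : ℤ_[p] → ℂ_[p] := fun e ↦ ∑' k, ((algebraMap ℚ_[p] ℂ_[p]).comp (algebraMap ℤ_[p] ℚ_[p])) (coeff k (binomialSeries ℤ_[p] e)) * z ^ k with hF_def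
  set G : ℤ_[p] → ℂ_[p] := fun e ↦ ρ (PadicInt.toZModPow n (cycPow p e)) with hG_def
  have hF : Continuous F := continuous_tsum_cpCoeff_binomialSeries hz
  have hG : Continuous G := continuous_apply_toZModPow_cycPow ρ
  have hFG : F = G := by
    refine Continuous.ext_on PadicInt.denseRange_natCast hF hG ?_
    rintro _ ⟨s, rfl⟩
    rw [hF_def, hG_def]
    dsimp only
    rw [(hasSum_cpCoeff_binomialSeries_natCast s z).tsum_eq, toZModPow_cycPow_natCast, map_pow,
      hz_def, add_sub_cancel]
  have hsum := (summable_map_coeff_mul_pow ((algebraMap ℚ_[p] ℂ_[p]).comp (algebraMap ℤ_[p] ℚ_[p]))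
    (norm_algebraMap_coeff_le_one (binomialSeries ℤ_[p] e)) hz).hasSum
  have hval : F e = G e := by rw [hFG]
  rw [hF_def, hG_def] at hval
  dsimp only at hval
  rwa [hval] at hsum

/-- **The regularising unit `1 − a(1 + T)^e` at `T = ρ(γ) − 1` takes the value `1 − a ρ(γ^e)`**
(Lang Ch. 4 §3: the factor `1 − χ(c)⟨c⟩^s`, `⟨c⟩ = γ^e`, of the Kubota–Leopoldt construction, in
the variable `T` and at a character point). [cite: LangCyclotomic1990, Ch. 4 §3 (the factor 1 − χ(c)⟨c⟩^s, PDF p. 84) and §1 Examples 1–2] -/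
theorem hasSum_cpCoeff_one_sub_C_mul_binomialSeries_character {n : ℕ}
    (ρ : DirichletCharacter ℂ_[p] (p ^ n)) (hord : ∃ j : ℕ, orderOf ρ = p ^ j) (a e : ℤ_[p]) :
    HasSum (fun k ↦ ((algebraMap ℚ_[p] ℂ_[p]).comp (algebraMap ℤ_[p] ℚ_[p])) (coeff k (1 - PowerSeries.C a * binomialSeries ℤ_[p] e)) *
        (ρ (cyclotomicGenerator p : ZMod (p ^ n)) - 1) ^ k)
      (1 - ((algebraMap ℚ_[p] ℂ_[p]).comp (algebraMap ℤ_[p] ℚ_[p])) a * ρ (PadicInt.toZModPow n (cycPow p e))) := by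
  have hz : ‖ρ (cyclotomicGenerator p : ZMod (p ^ n)) - 1‖ < 1 :=
    norm_apply_cyclotomicGenerator_sub_one_lt ρ hord
  have h1 := hasSum_map_coeff_one_mul_pow ((algebraMap ℚ_[p] ℂ_[p]).comp (algebraMap ℤ_[p] ℚ_[p])) (ρ (cyclotomicGenerator p : ZMod (p ^ n)) - 1)
  have h2 := hasSum_cpCoeff_mul hz (hasSum_map_coeff_C_mul_pow ((algebraMap ℚ_[p] ℂ_[p]).comp (algebraMap ℤ_[p] ℚ_[p])) a _)
    (hasSum_cpCoeff_binomialSeries_character ρ hord e)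
  have h := h1.sub h2
  refine h.congr_fun fun k ↦ ?_
  simp only [map_sub, sub_mul]

/-- **`1 − a ζ' ≠ 0` in `ℂ_p`** when `1 − a ∈ ℤ_pˣ` and `ζ'` is a `p`-power root of unity
(`|ζ' − 1| < 1`): `1 − aζ' = (1 − a) − a(ζ' − 1)` has norm `max(1, |a||ζ' − 1|) = 1` — the value
of the regularising unit is non-zero at every character point (Lang Ch. 4 §3 "then the factor in
front is also analytic", here: invertible). [cite: LangCyclotomic1990, Ch. 4 §3 (choice of c with χ(c) ≠ 1, PDF p. 84)] -/
theorem one_sub_mul_ne_zero_of_isUnit_of_norm_sub_one_lt {a : ℤ_[p]} (ha : IsUnit (1 - a))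
    {ζ : ℂ_[p]} (hζ : ‖ζ - 1‖ < 1) : (1 : ℂ_[p]) - ((algebraMap ℚ_[p] ℂ_[p]).comp (algebraMap ℤ_[p] ℚ_[p])) a * ζ ≠ 0 := by
  have hn1 : ‖(1 : ℂ_[p]) - ((algebraMap ℚ_[p] ℂ_[p]).comp (algebraMap ℤ_[p] ℚ_[p])) a‖ = 1 := by
    rw [← map_one (((algebraMap ℚ_[p] ℂ_[p]).comp (algebraMap ℤ_[p] ℚ_[p])) : ℤ_[p] →+* ℂ_[p]), ← map_sub, RingHom.comp_apply, norm_algebraMap',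
      PadicInt.algebraMap_apply, PadicInt.padic_norm_e_of_padicInt]
    exact PadicInt.isUnit_iff.mp ha
  have hlt : ‖((algebraMap ℚ_[p] ℂ_[p]).comp (algebraMap ℤ_[p] ℚ_[p])) a * (ζ - 1)‖ < 1 := by
    rw [norm_mul]
    calc ‖(((algebraMap ℚ_[p] ℂ_[p]).comp (algebraMap ℤ_[p] ℚ_[p])) : ℤ_[p] →+* ℂ_[p]) a‖ * ‖ζ - 1‖ ≤ 1 * ‖ζ - 1‖ := by
          gcongr; exact norm_iotaZ_le_one a
      _ < 1 := by rw [one_mul]; exact hζ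
  have e1 : (1 : ℂ_[p]) - ((algebraMap ℚ_[p] ℂ_[p]).comp (algebraMap ℤ_[p] ℚ_[p])) a * ζ = ((1 : ℂ_[p]) - ((algebraMap ℚ_[p] ℂ_[p]).comp (algebraMap ℤ_[p] ℚ_[p])) a) - ((algebraMap ℚ_[p] ℂ_[p]).comp (algebraMap ℤ_[p] ℚ_[p])) a * (ζ - 1) := by ring
  intro h0
  rw [e1, sub_eq_zero] at h0
  have := congr_arg norm h0
  rw [hn1] at this
  exact hlt.ne this.symm

end Literature.NumberTheory.EllipticCurves

end
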